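import Summits.Ventures.YMGap.RobustBall.RowsSU3Certified
import Summits.Ventures.YMGap.Thresholds.OneLinkVarianceBoundSU2
import HarnessLib

/-!
# Venture YMGap, track Y2 ROBUST-BALL — `d = 3` rows of the `ℤ^d` single-link ball theorem: `SU(2)` hypothesis-free (sharp pair) and
# `SU(3)` on the cell's certified pair — the strong-coupling RECEIVING END that track Y4 (YM3-IR) names

HONEST FRAMING.  Venture file of the cell `pub-ymgap` (QuantumFields programme), seat engine-2 (g5).  Strong-coupling LATTICE statements
only: `SU(2)` / `SU(3)` lattice Yang–Mills on `ℤ³` plus a link perturbation in the tier-1 ball (`MassGapOnBallZd 3 N β ε₀ ε₁ R`: every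
member has exactly one DLR state, exponentially clustering); Wilson coupling `β_W`, 't Hooft `β_W/N²`.  NOTHING about the continuum, the
ultraviolet (Bałaban) side of YM₃, or the Clay problem: Y4's dictionary says the effective coupling delivered by the UV flow is `β_W,eff ≥ 1`,
far above every row below — these rows quantify the receiving end, they do not close the gap.  Kernel ARITHMETIC over tree theorems:
rb-p1's `RobustBall.massGapOnBallZd_of_pair` (any `d ≥ 1`) fed, for `SU(2)`, with the tree's HYPOTHESIS-FREE pair — sharp Poincaré constant
`2/3` for every tilt (`oneLinkPoincareSUN_two_sharp`) and variance `2` on `‖B‖_op ≤ 3/10` (`OneLinkVarianceBoundSU2.oneLinkVarianceBound_two_threeTenths`),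
modulus `√(4/3)` — and, for `SU(3)`, with this seat's `RobustBallSU3.su3_massGapOnBallZd_of_certificates` (certified pair H1
`OneLinkPoincareSUN 3 (3/5) (4/5)`, H2 `OneLinkVarianceBound 3 (11/30) (49/20)`, modulus `7/5`; K-conditional on them, displayed).

THE ROWS (one-parameter convention `ε₀ = 2ε`, `ε₁ = ε`; `d = 3`, so one link sees `2(d−1) = 4` plaquettes and the tilt radius is `4·β_tH`):
* `SU(2)` (`β_tH = β_W/4`, radius `|β_W| ≤ 3/10`; row sum `ρ = 3√(4/3)|β_W| e^{2ε} + √(2/3) e^{ε} ε`, Wilson threshold `β_W = 1/(2√3) = 0.28868`;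
  HYPOTHESIS-FREE): `(β⋆_W, ε) = (1/10, .313) (1/8, .258) (1/7, .222) (1/6, .178) (1/5, .123) (9/40, .085) (1/4, .049)`;
* `SU(3)` (`β_tH = β_W/9`, radius `4|β_W|/9 ≤ 11/30 ⇔ |β_W| ≤ 33/40`; `ρ = (28/15)|β_W| e^{2ε} + √(4/5) e^{ε} ε`, threshold `15/28 = 0.536`; GIVEN H1, H2):
  `(β⋆_W, ε) = (1/5, .285) (1/4, .230) (15/56, .212) (3/10, .181) (1/3, .151) (2/5, .096) (9/20, .058) (1/2, .023)`.
Certificates: exact rational arithmetic with `e^x ≤ 1 + x + x²/2 + x³/6 + (5/96)x⁴` on `[0,1]` (`RobustBallSU3.exp_le_taylor4`), `√(4/3) ≤ 1.1548`,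
`√(2/3) ≤ 0.8165`, `√(4/5) ≤ 0.8945`.  Same door, same transfer (`e^{a}`, no self-Lipschitz factor) as the `d = 4` files `RobustBall/RowsSU2` (rb-p1)
and `RobustBall/RowsSU3Certified` (engine-2); numbers = engine-2's ROBUST-ONELINK-TABLE.md §E.
-/

noncomputable section

open MeasureTheory ProbabilityTheory Real
open Literature.MathematicalPhysics.QuantumFieldTheory
open Summit.QuantumFields.BalabanUV.InfraRed.StrongCouplingPoincareDoorSUN (OneLinkPoincareSUN oneLinkPoincareSUN_two_sharp)
open Summit.QuantumFields.BalabanUV.InfraRed.StrongCouplingVarianceDoorSUN (OneLinkVarianceBound)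
open Summit.Ventures.YMGap.RobustBall (MassGapOnBallZd massGapOnBallZd_of_pair)
open Summit.Ventures.YMGap.OneLinkVarianceBoundSU2 (oneLinkVarianceBound_two_threeTenths)
open Summit.Ventures.YMGap.RobustBallSU3 (exp_le_taylor4 sqrt_four_fifths_le su3_massGapOnBallZd_of_certificates)

namespace Summit.Ventures.YMGap.RobustBallDim3

/-! ### 1. `SU(2)`, `d = 3`, hypothesis-free, on the sharp pair `(c, v) = (2/3, 2)` -/

/-- `√(2/3) ≤ 0.8165` and `√((2/3)·2) ≤ 1.1548`. [folklore] -/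
theorem sqrt_bounds_su2 : Real.sqrt (2 / 3) ≤ 0.8165 ∧ Real.sqrt (2 / 3 * 2) ≤ 1.1548 := by
  constructor
  · rw [show (0.8165 : ℝ) = Real.sqrt (0.8165 ^ 2) by rw [Real.sqrt_sq (by norm_num)]]
    exact Real.sqrt_le_sqrt (by norm_num)
  · rw [show (1.1548 : ℝ) = Real.sqrt (1.1548 ^ 2) by rw [Real.sqrt_sq (by norm_num)]]
    exact Real.sqrt_le_sqrt (by norm_num)

/-- **`SU(2)`, `d = 3`, HYPOTHESIS-FREE ball theorem on the sharp pair**: for `|β_W| ≤ 3/10` (tilt radius `|β_W|`) and every `(ε₀, ε₁, R)` with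
`3√(4/3)·|β_W| e^{ε₀} + e^{ε₀/2} √(2/3) ε₁ < 1`: `MassGapOnBallZd 3 2 (β_W/4) ε₀ ε₁ R`.  Inputs by name: `oneLinkPoincareSUN_two_sharp (3/10)`,
`oneLinkVarianceBound_two_threeTenths`; door `massGapOnBallZd_of_pair`. [folklore] -/
theorem su2_dim3_massGapOnBallZd_sharp {βW ε₀ ε₁ : ℝ} (R : ℝ) (hβ : |βW| ≤ 3 / 10)
    (hρ : 3 * Real.sqrt (2 / 3 * 2) * |βW| * exp ε₀ + exp (ε₀ / 2) * Real.sqrt (2 / 3) * ε₁ < 1) :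
    MassGapOnBallZd 3 2 (βW / 4) ε₀ ε₁ R := by
  have hP : OneLinkPoincareSUN 2 (3 / 10) (2 / 3) := oneLinkPoincareSUN_two_sharp _
  have hV : OneLinkVarianceBound 2 (3 / 10) 2 := oneLinkVarianceBound_two_threeTenths
  have h4 : |βW / 4| = |βW| / 4 := by rw [abs_div, abs_of_pos (by norm_num : (0 : ℝ) < 4)]
  refine massGapOnBallZd_of_pair 3 2 (by norm_num) (by norm_num) R (by norm_num) (by norm_num) (b := 3 / 10) ?_
    (fun B hB => hP B hB) (fun B hB => hV B hB) ?_
  · rw [h4]; push_cast; linarith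
  · rw [h4]
    have e : 6 * (((3 : ℕ) : ℝ) - 1) * (|βW| / 4) * (exp ε₀ * Real.sqrt (2 / 3 * 2)) =
        3 * Real.sqrt (2 / 3 * 2) * |βW| * exp ε₀ := by push_cast; ring
    rw [e]
    exact hρ

/-- **`SU(2)`, `d = 3`, one-parameter row schema** (`ε₀ = 2ε`, `ε₁ = ε`): `0 ≤ β_W ≤ 3/10`, `0 ≤ ε ≤ 1/2` and the rational certificate
`3·1.1548·β_W·T(2ε) + T(ε)·0.8165·ε < 1` give `MassGapOnBallZd 3 2 (β_W/4) (2ε) ε R`, hypothesis-free. [folklore] -/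
theorem su2_dim3_row (R : ℝ) {βW ε : ℝ} (hβ0 : 0 ≤ βW) (hβ : βW ≤ 3 / 10) (hε0 : 0 ≤ ε) (hε1 : ε ≤ 1 / 2)
    (hcert : 3 * 1.1548 * βW * (1 + 2 * ε + (2 * ε) ^ 2 / 2 + (2 * ε) ^ 3 / 6 + 5 / 96 * (2 * ε) ^ 4) +
      (1 + ε + ε ^ 2 / 2 + ε ^ 3 / 6 + 5 / 96 * ε ^ 4) * 0.8165 * ε < 1) :
    MassGapOnBallZd 3 2 (βW / 4) (2 * ε) ε R := by
  refine su2_dim3_massGapOnBallZd_sharp R (by rw [abs_of_nonneg hβ0]; exact hβ) ?_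
  rw [abs_of_nonneg hβ0]
  have hT2 := exp_le_taylor4 (x := 2 * ε) (by linarith) (by linarith)
  have hT1 := exp_le_taylor4 (x := ε) hε0 (by linarith)
  have e2 : (2 * ε) / 2 = ε := by ring
  rw [e2]
  obtain ⟨hs23, hs43⟩ := sqrt_bounds_su2
  have hA : 3 * Real.sqrt (2 / 3 * 2) * βW * exp (2 * ε) ≤
      3 * 1.1548 * βW * (1 + 2 * ε + (2 * ε) ^ 2 / 2 + (2 * ε) ^ 3 / 6 + 5 / 96 * (2 * ε) ^ 4) :=
    mul_le_mul (mul_le_mul_of_nonneg_right (mul_le_mul_of_nonneg_left hs43 (by norm_num)) hβ0) hT2 (exp_pos _).le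
      (by positivity)
  have hB : exp ε * Real.sqrt (2 / 3) * ε ≤ (1 + ε + ε ^ 2 / 2 + ε ^ 3 / 6 + 5 / 96 * ε ^ 4) * 0.8165 * ε :=
    mul_le_mul_of_nonneg_right (mul_le_mul hT1 hs23 (Real.sqrt_nonneg _) (by positivity)) hε0
  linarith

/-- `SU(2)`, `d = 3`, row `(β⋆_W, ε) = (1/10, 0.313)` (hypothesis-free). [folklore] -/
theorem su2_dim3_row_1_10 (R : ℝ) : MassGapOnBallZd 3 2 ((1 / 10 : ℝ) / 4) (2 * (313 / 1000)) (313 / 1000) R :=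
  su2_dim3_row R (by norm_num) (by norm_num) (by norm_num) (by norm_num) (by norm_num)

/-- `SU(2)`, `d = 3`, row `(1/8, 0.258)`. [folklore] -/
theorem su2_dim3_row_1_8 (R : ℝ) : MassGapOnBallZd 3 2 ((1 / 8 : ℝ) / 4) (2 * (129 / 500)) (129 / 500) R :=
  su2_dim3_row R (by norm_num) (by norm_num) (by norm_num) (by norm_num) (by norm_num)

/-- `SU(2)`, `d = 3`, row `(1/7, 0.222)` — about half the Wilson threshold `1/(2√3) = 0.28868` of this door. [folklore] -/
theorem su2_dim3_row_1_7 (R : ℝ) : MassGapOnBallZd 3 2 ((1 / 7 : ℝ) / 4) (2 * (111 / 500)) (111 / 500) R :=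
  su2_dim3_row R (by norm_num) (by norm_num) (by norm_num) (by norm_num) (by norm_num)

/-- `SU(2)`, `d = 3`, row `(1/6, 0.178)`. [folklore] -/
theorem su2_dim3_row_1_6 (R : ℝ) : MassGapOnBallZd 3 2 ((1 / 6 : ℝ) / 4) (2 * (89 / 500)) (89 / 500) R :=
  su2_dim3_row R (by norm_num) (by norm_num) (by norm_num) (by norm_num) (by norm_num)

/-- `SU(2)`, `d = 3`, row `(1/5, 0.123)`. [folklore] -/
theorem su2_dim3_row_1_5 (R : ℝ) : MassGapOnBallZd 3 2 ((1 / 5 : ℝ) / 4) (2 * (123 / 1000)) (123 / 1000) R :=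
  su2_dim3_row R (by norm_num) (by norm_num) (by norm_num) (by norm_num) (by norm_num)

/-- `SU(2)`, `d = 3`, row `(9/40, 0.085)`. [folklore] -/
theorem su2_dim3_row_9_40 (R : ℝ) : MassGapOnBallZd 3 2 ((9 / 40 : ℝ) / 4) (2 * (17 / 200)) (17 / 200) R :=
  su2_dim3_row R (by norm_num) (by norm_num) (by norm_num) (by norm_num) (by norm_num)

/-- `SU(2)`, `d = 3`, row `(1/4, 0.049)`. [folklore] -/
theorem su2_dim3_row_1_4 (R : ℝ) : MassGapOnBallZd 3 2 ((1 / 4 : ℝ) / 4) (2 * (49 / 1000)) (49 / 1000) R :=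
  su2_dim3_row R (by norm_num) (by norm_num) (by norm_num) (by norm_num) (by norm_num)

/-! ### 2. `SU(3)`, `d = 3`, on the certified pair H1, H2 -/

/-- **`SU(3)`, `d = 3`, one-parameter row schema on the certificates**: `0 ≤ β_W ≤ 33/40`, `0 ≤ ε ≤ 1/2` and the rational certificate
`(28/15)β_W·T(2ε) + T(ε)·0.8945·ε < 1` give `MassGapOnBallZd 3 3 (β_W/9) (2ε) ε R`, GIVEN H1, H2. [folklore] -/
theorem su3_dim3_row (R : ℝ) (hP : OneLinkPoincareSUN 3 (3 / 5) (4 / 5)) (hV : OneLinkVarianceBound 3 (11 / 30) (49 / 20))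
    {βW ε : ℝ} (hβ0 : 0 ≤ βW) (hβ : βW ≤ 33 / 40) (hε0 : 0 ≤ ε) (hε1 : ε ≤ 1 / 2)
    (hcert : 28 / 15 * βW * (1 + 2 * ε + (2 * ε) ^ 2 / 2 + (2 * ε) ^ 3 / 6 + 5 / 96 * (2 * ε) ^ 4) +
      (1 + ε + ε ^ 2 / 2 + ε ^ 3 / 6 + 5 / 96 * ε ^ 4) * 0.8945 * ε < 1) :
    MassGapOnBallZd 3 3 (βW / 9) (2 * ε) ε R := by
  refine su3_massGapOnBallZd_of_certificates (d := 3) (by norm_num) R hP hV ?_ ?_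
  · rw [abs_of_nonneg hβ0]; push_cast; linarith
  · rw [abs_of_nonneg hβ0]
    have hT2 := exp_le_taylor4 (x := 2 * ε) (by linarith) (by linarith)
    have hT1 := exp_le_taylor4 (x := ε) hε0 (by linarith)
    have e2 : (2 * ε) / 2 = ε := by ring
    rw [e2]
    have hs := sqrt_four_fifths_le
    have hA : 14 / 15 * ((((3 : ℕ) : ℝ) - 1) * βW) * exp (2 * ε) ≤
        28 / 15 * βW * (1 + 2 * ε + (2 * ε) ^ 2 / 2 + (2 * ε) ^ 3 / 6 + 5 / 96 * (2 * ε) ^ 4) := by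
      have e : 14 / 15 * ((((3 : ℕ) : ℝ) - 1) * βW) = 28 / 15 * βW := by push_cast; ring
      rw [e]
      exact mul_le_mul_of_nonneg_left hT2 (by positivity)
    have hB : exp ε * Real.sqrt (4 / 5) * ε ≤ (1 + ε + ε ^ 2 / 2 + ε ^ 3 / 6 + 5 / 96 * ε ^ 4) * 0.8945 * ε :=
      mul_le_mul_of_nonneg_right (mul_le_mul hT1 hs (Real.sqrt_nonneg _) (by positivity)) hε0
    linarith

/-- `SU(3)`, `d = 3`, row `(β⋆_W, ε) = (1/5, 0.285)` on H1, H2. [folklore] -/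
theorem su3_dim3_row_1_5 (R : ℝ) (hP : OneLinkPoincareSUN 3 (3 / 5) (4 / 5)) (hV : OneLinkVarianceBound 3 (11 / 30) (49 / 20)) :
    MassGapOnBallZd 3 3 ((1 / 5 : ℝ) / 9) (2 * (57 / 200)) (57 / 200) R :=
  su3_dim3_row R hP hV (by norm_num) (by norm_num) (by norm_num) (by norm_num) (by norm_num)

/-- `SU(3)`, `d = 3`, row `(1/4, 0.230)`. [folklore] -/
theorem su3_dim3_row_1_4 (R : ℝ) (hP : OneLinkPoincareSUN 3 (3 / 5) (4 / 5)) (hV : OneLinkVarianceBound 3 (11 / 30) (49 / 20)) :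
    MassGapOnBallZd 3 3 ((1 / 4 : ℝ) / 9) (2 * (23 / 100)) (23 / 100) R :=
  su3_dim3_row R hP hV (by norm_num) (by norm_num) (by norm_num) (by norm_num) (by norm_num)

/-- `SU(3)`, `d = 3`, row `(15/56, 0.212)` — HALF the Wilson threshold `15/28` of this door on this pair. [folklore] -/
theorem su3_dim3_row_15_56 (R : ℝ) (hP : OneLinkPoincareSUN 3 (3 / 5) (4 / 5)) (hV : OneLinkVarianceBound 3 (11 / 30) (49 / 20)) :
    MassGapOnBallZd 3 3 ((15 / 56 : ℝ) / 9) (2 * (53 / 250)) (53 / 250) R :=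
  su3_dim3_row R hP hV (by norm_num) (by norm_num) (by norm_num) (by norm_num) (by norm_num)

/-- `SU(3)`, `d = 3`, row `(3/10, 0.181)`. [folklore] -/
theorem su3_dim3_row_3_10 (R : ℝ) (hP : OneLinkPoincareSUN 3 (3 / 5) (4 / 5)) (hV : OneLinkVarianceBound 3 (11 / 30) (49 / 20)) :
    MassGapOnBallZd 3 3 ((3 / 10 : ℝ) / 9) (2 * (181 / 1000)) (181 / 1000) R :=
  su3_dim3_row R hP hV (by norm_num) (by norm_num) (by norm_num) (by norm_num) (by norm_num)

/-- `SU(3)`, `d = 3`, row `(1/3, 0.151)`. [folklore] -/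
theorem su3_dim3_row_1_3 (R : ℝ) (hP : OneLinkPoincareSUN 3 (3 / 5) (4 / 5)) (hV : OneLinkVarianceBound 3 (11 / 30) (49 / 20)) :
    MassGapOnBallZd 3 3 ((1 / 3 : ℝ) / 9) (2 * (151 / 1000)) (151 / 1000) R :=
  su3_dim3_row R hP hV (by norm_num) (by norm_num) (by norm_num) (by norm_num) (by norm_num)

/-- `SU(3)`, `d = 3`, row `(2/5, 0.096)`. [folklore] -/
theorem su3_dim3_row_2_5 (R : ℝ) (hP : OneLinkPoincareSUN 3 (3 / 5) (4 / 5)) (hV : OneLinkVarianceBound 3 (11 / 30) (49 / 20)) :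
    MassGapOnBallZd 3 3 ((2 / 5 : ℝ) / 9) (2 * (12 / 125)) (12 / 125) R :=
  su3_dim3_row R hP hV (by norm_num) (by norm_num) (by norm_num) (by norm_num) (by norm_num)

/-- `SU(3)`, `d = 3`, row `(9/20, 0.058)` — the largest grid coupling with `ε ≥ 1/20`. [folklore] -/
theorem su3_dim3_row_9_20 (R : ℝ) (hP : OneLinkPoincareSUN 3 (3 / 5) (4 / 5)) (hV : OneLinkVarianceBound 3 (11 / 30) (49 / 20)) :
    MassGapOnBallZd 3 3 ((9 / 20 : ℝ) / 9) (2 * (29 / 500)) (29 / 500) R :=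
  su3_dim3_row R hP hV (by norm_num) (by norm_num) (by norm_num) (by norm_num) (by norm_num)

/-- `SU(3)`, `d = 3`, row `(1/2, 0.023)`. [folklore] -/
theorem su3_dim3_row_1_2 (R : ℝ) (hP : OneLinkPoincareSUN 3 (3 / 5) (4 / 5)) (hV : OneLinkVarianceBound 3 (11 / 30) (49 / 20)) :
    MassGapOnBallZd 3 3 ((1 / 2 : ℝ) / 9) (2 * (23 / 1000)) (23 / 1000) R :=
  su3_dim3_row R hP hV (by norm_num) (by norm_num) (by norm_num) (by norm_num) (by norm_num)

/-- Numbers: the two Wilson thresholds of the `d = 3` single-link door — `SU(2)` sharp pair: `3√(4/3)·β_W = 1` at `β_W = 1/(2√3)`, bracketed by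
`3·1.1547·(2886/10000) < 1 < 3·1.1548·(289/1000)`; `SU(3)` certified pair: `(28/15)·(15/28) = 1`; radii `3/10` resp. `4·(33/40)/9 = 11/30`; half-thresholds
`15/56 = (15/28)/2`. [folklore] -/
theorem dim3_numbers :
    (3 : ℝ) * 1.1547 * (2886 / 10000) < 1 ∧ (1 : ℝ) < 3 * 1.1548 * (289 / 1000) ∧ (28 / 15 : ℝ) * (15 / 28) = 1 ∧
      (4 : ℝ) * (33 / 40) / 9 = 11 / 30 ∧ (15 / 56 : ℝ) = (15 / 28) / 2 ∧ (1.1547 : ℝ) ^ 2 < 4 / 3 := by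
  norm_num

end Summit.Ventures.YMGap.RobustBallDim3

end
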